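import Mathlib
import HarnessLib
import Summits.CriticalPhenomena.PercolationContinuityZ3.Theses.PercLayerChain
import Summits.CriticalPhenomena.PercolationContinuityZ3.Theorems.PercLowPointHalfSpaceLowPointIdentityShift
import Summits.CriticalPhenomena.PercolationContinuityZ3.Theorems.PercLowPointHalfSpaceAssemblyWallExit
import Literature.Probability.Percolation.BondPercolationSymmetry
import Literature.Probability.Percolation.ConstrainedClusters
import Literature.Probability.Percolation.HalfSpacePinnedPairs

/-!
# Route `PercLayerChain`, item `HazardSuffices`: a lineage hazard `≥ c/t` forces `s_t → 0`

Item `stmt-CriticalPhenomena-5755` of route `CriticalPhenomena/PercLayerChain`, decl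
`Summit.CriticalPhenomena.PercolationContinuityZ3.Theses.PercLayerChain.HazardSuffices`
(`LineageHazard → ShadowDensityVanishes`).

Notation (fixed half-space `ℍ = {x ∈ ℤ^d | 0 ≤ x₀}`, floor `∂ℍ = {x₀ = 0}`, `y_t = t e₀`,
`e₀ = Pi.single 0 1`): the *shadow density* is `s_t = P(y_t ↔ ∂ℍ in ℍ)` and the *hazard event*
is `Haz_t = {y_t ↔ ∂ℍ in ℍ, and every floor point so reached has its edge to {x₀ = -1} closed}`.
The item does NOT receive the route's `DeathLaw` (`s_t - s_{t+1} = P(Haz_t)`) as a hypothesis, so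
this file proves the one-sided death inequality it needs:

* `LayerChain.exists_floor_downEdge` — **first down-crossing** (deterministic, `ω ⊆ E(ℤ^d)`): an
  open path from a point of `ℍ` to level `-1` inside `{-1 ≤ x₀}` leaves `ℍ` for the first time
  through a vertical edge `(c, c - e₀)` at a floor point `c` joined to the start inside `ℍ`.
* `LayerChain.shift_preimage_shadow_succ` — **vertical shift**: `ω + e₀ ∈ {y_{t+1} ↔ ∂ℍ in ℍ}`
  iff `ω ∈ {y_t ↔ {x₀ = -1} in {-1 ≤ x₀}}`.
* `LayerChain.measure_shadow_succ_add_hazard_le` — hence, for every `p` and every `d ≥ 1`,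
  `P_p(y_{t+1} ↔ ∂ℍ in ℍ) + P_p(Haz_t) ≤ P_p(y_t ↔ ∂ℍ in ℍ)` (translation invariance
  `bondPercolation_map_shift`, `ω ⊆ E(ℤ^d)` a.s., and `μ(A ∩ C) + μ(A \ C) = μ A`).
* `LayerChain.tendsto_zero_of_hazard` — the elementary recursion: `0 ≤ s`,
  `s_{t+1} ≤ s_t - (c/t) s_t` for `t ≥ 1`, `c > 0` imply `s_t → 0` (telescoping
  `Σ_{t<N} (c/t) s_t ≤ s_1` against the divergence of the harmonic series).
* `hazardSuffices_proof` — the item, of the exact route type.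

Sources: G. Grimmett, *Percolation*, 2nd ed. (1999), §1.6 (translation invariance of `P_p`),
§7.2 p. 148 (paths "in `A`"); the first-passage decomposition at the floor is elementary.
-/

noncomputable section

namespace Summit.CriticalPhenomena.PercolationContinuityZ3.Theorems

open MeasureTheory Filter Topology
open Literature.Probability.Percolation Literature.Probability.LatticeModels
open scoped ENNReal

namespace LayerChain

open LowPoint

variable {d : ℕ}

/-! ## First down-crossing of the floor -/

section DownCrossing

variable [NeZero d]

/-- **First down-crossing.** Let `ω` open only lattice edges, `a ∈ ℍ = {0 ≤ x₀}`, `w₀ = -1`, and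
`a ↔ w` inside `{-1 ≤ x₀}`. Then some floor point `c` (`c₀ = 0`) is joined to `a` inside `ℍ` and
has its downward edge `s(c, c - e₀)` open: the first step of an open path `a → w` leaving the
`ℍ`-cluster of `a` must leave `ℍ`, hence goes from the floor straight down. [folklore] -/
theorem exists_floor_downEdge {ω : BondConfig (Site d)} (hω : ω ⊆ (zdGraph d).edgeSet)
    {a w : Site d} (ha : 0 ≤ a 0) (hw : w 0 = -1)
    (haw : ω ∈ openConnIn {x : Site d | -1 ≤ x 0} a w) :
    ∃ c : Site d, c 0 = 0 ∧ ω ∈ openConnIn {x : Site d | 0 ≤ x 0} a c ∧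
      s(c, c - Pi.single 0 1) ∈ ω := by
  set H : Set (Site d) := {x | 0 ≤ x 0} with hH
  set L : Set (Site d) := {x | -1 ≤ x 0} with hL
  have haH : a ∈ H := ha
  have haL : a ∈ L := haw.1
  -- `D` = the open cluster of `a` inside `H`
  set D : Set (Site d) := openClusterIn (withinGraph ⊤ H) ω a with hD
  have hDH : D ⊆ H := openClusterIn_withinGraph_subset haH ω
  have haD : a ∈ D := self_mem_openClusterIn _ ω a
  have hwD : w ∉ D := fun h => by
    have h' : 0 ≤ w 0 := hDH h
    omega
  -- an open walk from `a` to `w` inside `L` leaves `D` somewhere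
  have hreach : (openGraph ω ⊓ withinGraph ⊤ L).Reachable a w :=
    mem_openClusterIn_iff.1 ((conn_iff_mem_cluster haL).1 haw)
  obtain ⟨c, c', hcD, hc'D, hadj⟩ := exists_adj_mem_not_mem hreach.some haD hwD
  rw [SimpleGraph.inf_adj, openGraph_adj, withinGraph_adj] at hadj
  obtain ⟨⟨hopen, hne⟩, -, -, hc'L⟩ := hadj
  have hcH : c ∈ H := hDH hcD
  -- the exit vertex `c'` is not in `H` (else it would be in `D`)
  have hc'H : c' ∉ H := fun hc'H =>
    hc'D (mem_openClusterIn_of_adj hcD ⟨(SimpleGraph.top_adj c c').2 hne, hcH, hc'H⟩ hopen)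
  have hc'0 : c' 0 = -1 := by
    have h1 : ¬ (0 ≤ c' 0) := hc'H
    have h2 : -1 ≤ c' 0 := hc'L
    omega
  have hc0 : 0 ≤ c 0 := hcH
  -- lattice adjacency forces `c = c' + e₀`
  have hlat : (zdGraph d).Adj c c' := by
    have := hω hopen
    rwa [SimpleGraph.mem_edgeSet] at this
  have hceq : c = c' + Pi.single 0 1 := by
    obtain ⟨i, hi | hi⟩ := (zdGraph_adj_iff c c').1 hlat
    · exfalso
      have h0 := congrFun hi 0
      have hs : (0 : ℤ) ≤ (Pi.single i (1 : ℤ) : Site d) 0 := by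
        rcases eq_or_ne i 0 with rfl | hi0
        · rw [Pi.single_eq_same]; norm_num
        · rw [Pi.single_eq_of_ne hi0.symm]
      rw [Pi.add_apply] at h0
      omega
    · rcases eq_or_ne i 0 with rfl | hi0
      · exact hi
      · exfalso
        have h0 := congrFun hi 0
        rw [Pi.add_apply, Pi.single_eq_of_ne hi0.symm, add_zero] at h0
        omega
  refine ⟨c, ?_, (conn_iff_mem_cluster haH).2 hcD, ?_⟩
  · have h0 := congrFun hceq 0
    rw [Pi.add_apply, Pi.single_eq_same] at h0
    omega
  · have h' : c - Pi.single 0 1 = c' := by rw [hceq, add_sub_cancel_right]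
    rw [h']
    exact hopen

end DownCrossing

/-! ## The vertical shift by one layer -/

section Shift

variable [NeZero d]

/-- **Vertical shift of the shadow event.** `ω + e₀ ∈ {y_{t+1} ↔ ∂ℍ in ℍ}` iff
`ω ∈ {y_t ↔ {x₀ = -1} in {-1 ≤ x₀}}`. [folklore] -/
theorem shift_preimage_shadow_succ (t : ℕ) (ω : BondConfig (Site d)) :
    BondConfig.relabel (sym2Equiv (Site.shift (Pi.single 0 (1 : ℤ)))) ω ∈
        {ω : BondConfig (Site d) | ∃ w : Site d, w 0 = 0 ∧
          ω ∈ openConnIn {x : Site d | 0 ≤ x 0} (Pi.single 0 ((t : ℤ) + 1)) w} ↔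
      ∃ w : Site d, w 0 = -1 ∧
        ω ∈ openConnIn {x : Site d | -1 ≤ x 0} (Pi.single 0 (t : ℤ)) w := by
  have hlevel : ((fun x : Site d => x + Pi.single 0 (1 : ℤ)) ⁻¹' {x : Site d | (0 : ℤ) ≤ x 0}) =
      {x : Site d | -1 ≤ x 0} := by
    rw [preimage_add_level]
    simp only [Pi.single_eq_same, zero_sub]
  have hy : (Pi.single 0 ((t : ℤ) + 1) : Site d) - Pi.single 0 (1 : ℤ) = Pi.single 0 (t : ℤ) := by
    rw [← Pi.single_sub, add_sub_cancel_right]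
  simp only [Set.mem_setOf_eq]
  constructor
  · rintro ⟨w, hw0, hw⟩
    rw [shift_mem_openConnIn_iff_sub, hlevel, hy] at hw
    refine ⟨w - Pi.single 0 1, ?_, hw⟩
    rw [Pi.sub_apply, Pi.single_eq_same, hw0]
    norm_num
  · rintro ⟨w, hw0, hw⟩
    refine ⟨w + Pi.single 0 1, ?_, ?_⟩
    · rw [Pi.add_apply, Pi.single_eq_same, hw0]
      norm_num
    · rw [shift_mem_openConnIn_iff_sub, hlevel, hy, add_sub_cancel_right]
      exact hw

end Shift

/-! ## The one-sided death inequality -/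

section Death

variable [NeZero d]

/-- The "all down-edges closed" condition is a measurable event (countably many floor points;
`{x ↔ y in S}` and `{e open}` are measurable). [folklore] -/
theorem measurableSet_allClosed (t : ℕ) :
    MeasurableSet {ω : BondConfig (Site d) | ∀ w : Site d, w 0 = 0 →
      ω ∈ openConnIn {x : Site d | 0 ≤ x 0} (Pi.single 0 (t : ℤ)) w →
        s(w, w - Pi.single 0 1) ∉ ω} := by
  refine measurableSet_setOf.2 (Measurable.forall fun w => ?_)
  refine Measurable.imp measurable_const (Measurable.imp ?_ ?_)
  · exact (measurableSet_openConnIn_of_countable _ _ _).mem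
  · exact (measurable_set_mem _).not

/-- **One-sided death inequality** (every `p`, every `d ≥ 1`):
`P_p(y_{t+1} ↔ ∂ℍ in ℍ) + P_p(Haz_t) ≤ P_p(y_t ↔ ∂ℍ in ℍ)`, where
`Haz_t = {y_t ↔ ∂ℍ in ℍ and every floor point so reached has its edge to {x₀ = -1} closed}`.
Proof: by the vertical shift `P_p(y_{t+1} ↔ ∂ℍ in ℍ) = P_p(y_t ↔ {x₀ = -1} in {-1 ≤ x₀})`, and
a.s. the latter event lies in `{y_t ↔ ∂ℍ in ℍ} ∖ Haz_t` (first down-crossing). [folklore] -/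
theorem measure_shadow_succ_add_hazard_le (p : unitInterval) (t : ℕ) :
    bondPercolation (zdGraph d) p
        {ω | ∃ w : Site d, w 0 = 0 ∧
          ω ∈ openConnIn {x : Site d | 0 ≤ x 0} (Pi.single 0 ((t : ℤ) + 1)) w} +
      bondPercolation (zdGraph d) p
        {ω | (∃ w : Site d, w 0 = 0 ∧
            ω ∈ openConnIn {x : Site d | 0 ≤ x 0} (Pi.single 0 (t : ℤ)) w) ∧
          ∀ w : Site d, w 0 = 0 →
            ω ∈ openConnIn {x : Site d | 0 ≤ x 0} (Pi.single 0 (t : ℤ)) w →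
              s(w, w - Pi.single 0 1) ∉ ω} ≤
      bondPercolation (zdGraph d) p
        {ω | ∃ w : Site d, w 0 = 0 ∧
          ω ∈ openConnIn {x : Site d | 0 ≤ x 0} (Pi.single 0 (t : ℤ)) w} := by
  set μ := bondPercolation (zdGraph d) p with hμ
  set A : Set (BondConfig (Site d)) := {ω | ∃ w : Site d, w 0 = 0 ∧
    ω ∈ openConnIn {x : Site d | 0 ≤ x 0} (Pi.single 0 (t : ℤ)) w} with hA
  set C : Set (BondConfig (Site d)) := {ω | ∀ w : Site d, w 0 = 0 →
    ω ∈ openConnIn {x : Site d | 0 ≤ x 0} (Pi.single 0 (t : ℤ)) w →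
      s(w, w - Pi.single 0 1) ∉ ω} with hC
  set A₁ : Set (BondConfig (Site d)) := {ω | ∃ w : Site d, w 0 = 0 ∧
    ω ∈ openConnIn {x : Site d | 0 ≤ x 0} (Pi.single 0 ((t : ℤ) + 1)) w} with hA₁
  set A' : Set (BondConfig (Site d)) := {ω | ∃ w : Site d, w 0 = -1 ∧
    ω ∈ openConnIn {x : Site d | -1 ≤ x 0} (Pi.single 0 (t : ℤ)) w} with hA'
  have hE : {ω : BondConfig (Site d) | (∃ w : Site d, w 0 = 0 ∧
      ω ∈ openConnIn {x : Site d | 0 ≤ x 0} (Pi.single 0 (t : ℤ)) w) ∧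
        ∀ w : Site d, w 0 = 0 →
          ω ∈ openConnIn {x : Site d | 0 ≤ x 0} (Pi.single 0 (t : ℤ)) w →
            s(w, w - Pi.single 0 1) ∉ ω} = A ∩ C := rfl
  have hCm : MeasurableSet C := measurableSet_allClosed t
  -- vertical shift
  have hshift : μ A₁ = μ A' := by
    have hset : BondConfig.relabel (sym2Equiv (Site.shift (Pi.single 0 (1 : ℤ)))) ⁻¹' A₁ = A' := by
      ext ω
      rw [Set.mem_preimage]
      exact shift_preimage_shadow_succ t ω
    rw [← hset, hμ, measure_preimage_shift']
  -- a.s. inclusion `A' ⊆ A \ C` (first down-crossing)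
  have hae : ∀ᵐ ω ∂μ, ω ⊆ (zdGraph d).edgeSet := ProbabilityTheory.setBernoulli_ae_subset
  have hle : μ A' ≤ μ (A \ C) := by
    refine measure_mono_ae ?_
    filter_upwards [hae] with ω hω
    intro hωA'
    obtain ⟨w, hw0, hw⟩ := hωA'
    have hy : (0 : ℤ) ≤ (Pi.single 0 (t : ℤ) : Site d) 0 := by
      rw [Pi.single_eq_same]; exact Int.natCast_nonneg t
    obtain ⟨c, hc0, hc, hopen⟩ := exists_floor_downEdge hω hy hw0 hw
    exact ⟨⟨c, hc0, hc⟩, fun hall => hall c hc0 hc hopen⟩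
  rw [hE]
  calc μ A₁ + μ (A ∩ C) = μ A' + μ (A ∩ C) := by rw [hshift]
    _ ≤ μ (A \ C) + μ (A ∩ C) := add_le_add hle le_rfl
    _ = μ A := by rw [add_comm, measure_inter_add_sdiff A hCm]

/-- Real-valued form of `measure_shadow_succ_add_hazard_le`:
`s_{t+1} + P_p(Haz_t) ≤ s_t` with `Measure.real`. [folklore] -/
theorem real_shadow_succ_add_hazard_le (p : unitInterval) (t : ℕ) :
    (bondPercolation (zdGraph d) p).real
        {ω | ∃ w : Site d, w 0 = 0 ∧
          ω ∈ openConnIn {x : Site d | 0 ≤ x 0} (Pi.single 0 ((t : ℤ) + 1)) w} +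
      (bondPercolation (zdGraph d) p).real
        {ω | (∃ w : Site d, w 0 = 0 ∧
            ω ∈ openConnIn {x : Site d | 0 ≤ x 0} (Pi.single 0 (t : ℤ)) w) ∧
          ∀ w : Site d, w 0 = 0 →
            ω ∈ openConnIn {x : Site d | 0 ≤ x 0} (Pi.single 0 (t : ℤ)) w →
              s(w, w - Pi.single 0 1) ∉ ω} ≤
      (bondPercolation (zdGraph d) p).real
        {ω | ∃ w : Site d, w 0 = 0 ∧
          ω ∈ openConnIn {x : Site d | 0 ≤ x 0} (Pi.single 0 (t : ℤ)) w} := by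
  have h := measure_shadow_succ_add_hazard_le (d := d) p t
  simp only [measureReal_def]
  rw [← ENNReal.toReal_add (measure_ne_top _ _) (measure_ne_top _ _)]
  exact ENNReal.toReal_mono (measure_ne_top _ _) h

end Death

/-! ## The elementary recursion -/

/-- **Hazard recursion.** If `0 ≤ s_t`, `c > 0` and `s_{t+1} ≤ s_t - (c/t)·s_t` for all `t ≥ 1`,
then `s_t → 0`: telescoping gives `Σ_{u<N} (c/(u+1)) s_{u+1} ≤ s_1`, the sequence is
non-increasing from `t = 1` on, and the harmonic series diverges. [folklore] -/
theorem tendsto_zero_of_hazard {s : ℕ → ℝ} {c : ℝ} (hc : 0 < c) (h0 : ∀ t, 0 ≤ s t)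
    (hstep : ∀ t : ℕ, 1 ≤ t → s (t + 1) ≤ s t - c / (t : ℝ) * s t) :
    Tendsto s atTop (𝓝 0) := by
  -- monotonicity from `t = 1` on
  have hmono : ∀ t : ℕ, 1 ≤ t → s (t + 1) ≤ s t := fun t ht =>
    (hstep t ht).trans (sub_le_self _ (mul_nonneg (div_nonneg hc.le (Nat.cast_nonneg t)) (h0 t)))
  have hanti : ∀ k m : ℕ, 1 ≤ k → k ≤ m → s m ≤ s k := by
    intro k m hk hkm
    induction m, hkm using Nat.le_induction with
    | base => exact le_rfl
    | succ m hkm ih => exact (hmono m (le_trans hk hkm)).trans ih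
  -- telescoping
  have htel : ∀ N : ℕ, ∑ u ∈ Finset.range N, c / ((u : ℝ) + 1) * s (u + 1) ≤ s 1 - s (N + 1) := by
    intro N
    induction N with
    | zero => simp
    | succ N ih =>
      rw [Finset.sum_range_succ]
      have h := hstep (N + 1) (Nat.succ_le_succ (Nat.zero_le N))
      push_cast at h
      linarith
  rw [Metric.tendsto_atTop]
  intro ε hε
  obtain ⟨N₀, hN₀⟩ := Filter.eventually_atTop.1
    (Filter.tendsto_atTop.1 Real.tendsto_sum_range_one_div_nat_succ_atTop (s 1 / (c * ε) + 1))
  refine ⟨N₀ + 1, fun n hn => ?_⟩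
  rw [Real.dist_0_eq_abs, abs_of_nonneg (h0 n)]
  by_contra hcon
  have hcon : ε ≤ s n := not_lt.1 hcon
  obtain ⟨N, rfl⟩ : ∃ N, n = N + 1 := ⟨n - 1, by omega⟩
  have hN : N₀ ≤ N := by omega
  have hcε : 0 < c * ε := mul_pos hc hε
  -- lower bound of the telescoped sum
  have hlow : c * ε * ∑ u ∈ Finset.range N, (1 : ℝ) / ((u : ℝ) + 1) ≤
      ∑ u ∈ Finset.range N, c / ((u : ℝ) + 1) * s (u + 1) := by
    rw [Finset.mul_sum]
    refine Finset.sum_le_sum fun u hu => ?_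
    rw [Finset.mem_range] at hu
    have hsu : ε ≤ s (u + 1) := hcon.trans (hanti (u + 1) (N + 1) (Nat.succ_le_succ (Nat.zero_le u))
      (by omega))
    have hpos : 0 ≤ c / ((u : ℝ) + 1) := div_nonneg hc.le (by positivity)
    calc c * ε * (1 / ((u : ℝ) + 1)) = c / ((u : ℝ) + 1) * ε := by ring
      _ ≤ c / ((u : ℝ) + 1) * s (u + 1) := mul_le_mul_of_nonneg_left hsu hpos
  have hharm : s 1 / (c * ε) + 1 ≤ ∑ u ∈ Finset.range N, (1 : ℝ) / ((u : ℝ) + 1) := hN₀ N hN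
  have h1 : c * ε * (s 1 / (c * ε) + 1) = s 1 + c * ε := by
    field_simp
  have h2 : s 1 + c * ε ≤ s 1 - s (N + 1 + 1) := by
    calc s 1 + c * ε = c * ε * (s 1 / (c * ε) + 1) := h1.symm
      _ ≤ c * ε * ∑ u ∈ Finset.range N, (1 : ℝ) / ((u : ℝ) + 1) :=
          mul_le_mul_of_nonneg_left hharm hcε.le
      _ ≤ ∑ u ∈ Finset.range N, c / ((u : ℝ) + 1) * s (u + 1) := hlow
      _ ≤ s 1 - s (N + 1) := htel N
      _ ≤ s 1 - s (N + 1 + 1) := by linarith [hmono (N + 1) (Nat.succ_le_succ (Nat.zero_le N))]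
  linarith [h0 (N + 1 + 1)]

end LayerChain

/-! ## The item -/

open LayerChain in
/-- **`HazardSuffices`** (item `stmt-CriticalPhenomena-5755`, exact route type):
`LineageHazard → ShadowDensityVanishes`. With the one-sided death inequality
`s_{t+1} + P(Haz_t) ≤ s_t` (`LayerChain.real_shadow_succ_add_hazard_le`) the hazard bound
`P(Haz_t) ≥ (c/t) s_t` gives `s_{t+1} ≤ (1 - c/t) s_t` for `t ≥ 1`, whence `s_t → 0`
(`LayerChain.tendsto_zero_of_hazard`). [folklore] -/
theorem hazardSuffices_proof : Theses.PercLayerChain.HazardSuffices := by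
  rintro ⟨c, hc, hhaz⟩
  unfold Theses.PercLayerChain.ShadowDensityVanishes
  refine tendsto_zero_of_hazard hc (fun t => measureReal_nonneg) (fun t ht => ?_)
  have h1 := hhaz t ht
  have h2 := real_shadow_succ_add_hazard_le (d := 3) (criticalProbI 3) t
  have hcast : (((t + 1 : ℕ) : ℤ)) = (t : ℤ) + 1 := by push_cast; ring
  simp only [hcast]
  linarith

end Summit.CriticalPhenomena.PercolationContinuityZ3.Theorems

end
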